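import Summits.NavierStokesRegularity.NavierStokesRegularity.Theorems.EfficiencyFloorRigidExitTangentCone
import HarnessLib

/-!
# Route `EfficiencyFloor`, support `RigidExit` (stmt-25513) on the `ProductionEfficiencyDecay` ladder (stmt-22866):
# the ENSTROPHY-CONTROLLED tangent-cone condition (TC_Z) suffices

Helper file (`--supports stmt-NavierStokesRegularity-22866`; line `efficiency_floor`), sequel to `…RigidExitTangentCone`. There,
item (i) ORBIT SELECTION of `RigidExit` was replaced by the static condition (TC) on the normalised-maximiser set 𝓜 («pointwise right
tangents of 𝓜 are infinitesimal symmetries»). Here the hypothesis is WEAKENED to (TC_Z): only tangents `h = lim τₙ⁻¹(wₙ − m)` whose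
approximating maximisers ALSO satisfy `Z(wₙ) → Z(m)` need to be infinitesimal symmetries. Along a classical flow of the route class
the enstrophy is continuous (landed sharp budget), so the difference quotients of the flow meet (TC_Z), and the conclusions persist:

* `no_maximiserInterval_of_tangentCone_enstrophy`, `exists_nonMaximiser_instant_of_tangentCone_enstrophy`,
  `earlyDeficit_everywhere_of_tangentCone_enstrophy` (BY NAME, sharp constant `c⋆`).

Why the weakening matters: a proof of the tangent-cone condition from clause (a) of `MaximiserSetRigidity` (finitely many orbits)
must first pin the SCALES of the `wₙ` in their orbit representations — `l = Z(wₙ)/Z(ms i)` (`ScaleClock.scale_eq_enstrophy_ratio`) —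
which (TC_Z) hands over for free; what is then left is the Euclidean slice (rotations/translations, compact stabiliser).
HONEST FRAMING: statements about a HYPOTHETICAL blow-up; (TC_Z), clause (a), `RigidExit`, `NearMaximiserBoundedAmplification`,
`LerayFloorGap`, `ProductionEfficiencyDecay` (stmt-22866) and Navier–Stokes regularity stay OPEN; no summit statement is proved.
[folklore]
-/

-- the problem directory repeats the summit name (`NavierStokesRegularity/NavierStokesRegularity`)
set_option linter.dupNamespace false

noncomputable section

open Set Filter MeasureTheory Topology Function
open scoped InnerProductSpace RealInnerProductSpace ENNReal NNReal Laplacian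
open Literature.Analysis.FluidPDE

namespace Summit.NavierStokesRegularity.NavierStokesRegularity.Theorems

namespace RigidExit

namespace TangentCone

open NearMaximiserBoundedAmplification MaximiserSetRigidity.ProfileLiouville Resonance

/-! ## (TC_Z): the enstrophy-controlled tangent-cone condition

(TC_Z) is (TC) with the approximating normalised maximisers `wₙ` additionally required to satisfy `Z(wₙ) → Z(m)`; a tangent
realised along a classical flow has this property (continuity of the enstrophy, from the landed sharp budget), so the conclusions
of §1–§2 persist. The extra control pins the SCALES of the `wₙ` in any orbit representation (`…ScaleClock`), which is what a proof
of (TC_Z) from clause (a) (compactness modulo the symmetry group, `…OrbitClosed`) starts from. -/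

/-- **(TC_Z) ⟹ NO MAXIMISER INTERVAL** (sharp constant `c⋆`): the same as `no_maximiserInterval_of_tangentCone` under the WEAKER
enstrophy-controlled tangent-cone condition (TC_Z), whose approximating maximisers `wₙ` are also required to have
`Z(wₙ) → Z(m)` (along the flow this holds by continuity of the enstrophy). Under (TC_Z) at `(c⋆, ν)`, along every maximal
classical solution on `[0,T)` that is Leray–Hopf from a rapidly decaying datum, no interval `[s,s₁] ⊂ (0,T)` consists of normalised
maximisers (route clause verbatim): `∂ₜu(s)` would be an infinitesimal symmetry at `u(s)` and the momentum equation would make `u(s)`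
a relative equilibrium, contradicting part (b) (`ProfileLiouville.partB_holds`). [folklore] -/
theorem no_maximiserInterval_of_tangentCone_enstrophy :
    ∃ c : ℝ, (0 < c ∧ (∀ v : EuclideanSpace ℝ (Fin 3) → EuclideanSpace ℝ (Fin 3), (ContDiff ℝ (⊤ : ℕ∞) v ∧
      VectorCalculus.IsDivFree v ∧ (∫⁻ x, ‖iteratedFDeriv ℝ 0 v x‖ₑ ^ 2 < ⊤) ∧ (∫⁻ x, ‖iteratedFDeriv ℝ 1 v x‖ₑ ^ 2 < ⊤) ∧
      (∫⁻ x, ‖iteratedFDeriv ℝ 2 v x‖ₑ ^ 2 < ⊤)) → (∫ x, ⟪curl v x, fderiv ℝ v x (curl v x)⟫_ℝ) ≤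
      c * (∫ x, ‖curl v x‖ ^ 2) ^ (3 / 4 : ℝ) * (∫ x, frobeniusNormSq (fderiv ℝ (curl v) x)) ^ (3 / 4 : ℝ)) ∧
      ∀ c' : ℝ, (∀ w : EuclideanSpace ℝ (Fin 3) → EuclideanSpace ℝ (Fin 3), (ContDiff ℝ (⊤ : ℕ∞) w ∧
      VectorCalculus.IsDivFree w ∧ (∫⁻ x, ‖iteratedFDeriv ℝ 0 w x‖ₑ ^ 2 < ⊤) ∧ (∫⁻ x, ‖iteratedFDeriv ℝ 1 w x‖ₑ ^ 2 < ⊤) ∧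
      (∫⁻ x, ‖iteratedFDeriv ℝ 2 w x‖ₑ ^ 2 < ⊤)) → (∫ x, ⟪curl w x, fderiv ℝ w x (curl w x)⟫_ℝ) ≤
      c' * (∫ x, ‖curl w x‖ ^ 2) ^ (3 / 4 : ℝ) * (∫ x, frobeniusNormSq (fderiv ℝ (curl w) x)) ^ (3 / 4 : ℝ)) → c ≤ c') ∧
      ∀ (ν T : ℝ), 0 < ν → 0 < T →
      ∀ (u : ℝ → EuclideanSpace ℝ (Fin 3) → EuclideanSpace ℝ (Fin 3)) (p : ℝ → EuclideanSpace ℝ (Fin 3) → ℝ),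
      IsMaximalSmoothSolution ν 0 u p T → IsLerayHopfOn T ν 0 (u 0) u → HasRapidSpatialDecay (u 0) →
      -- (TC_Z) at `(c, ν)`
      (∀ m : EuclideanSpace ℝ (Fin 3) → EuclideanSpace ℝ (Fin 3), ((ContDiff ℝ (⊤ : ℕ∞) m ∧ VectorCalculus.IsDivFree m ∧
        (∫⁻ x, ‖iteratedFDeriv ℝ 0 m x‖ₑ ^ 2 < ⊤) ∧ (∫⁻ x, ‖iteratedFDeriv ℝ 1 m x‖ₑ ^ 2 < ⊤) ∧
        (∫⁻ x, ‖iteratedFDeriv ℝ 2 m x‖ₑ ^ 2 < ⊤)) ∧ 0 < (∫ x, ‖curl m x‖ ^ 2) ∧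
        (∫ x, ⟪curl m x, fderiv ℝ m x (curl m x)⟫_ℝ) = c * (∫ x, ‖curl m x‖ ^ 2) ^ (3 / 4 : ℝ) *
          (∫ x, frobeniusNormSq (fderiv ℝ (curl m) x)) ^ (3 / 4 : ℝ) ∧
        (∫ x, frobeniusNormSq (fderiv ℝ (curl m) x)) = 81 * c ^ 4 / (256 * ν ^ 4) * (∫ x, ‖curl m x‖ ^ 2) ^ 3) →
        ∀ h : EuclideanSpace ℝ (Fin 3) → EuclideanSpace ℝ (Fin 3),
        (∃ (w : ℕ → EuclideanSpace ℝ (Fin 3) → EuclideanSpace ℝ (Fin 3)) (τ : ℕ → ℝ),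
          (∀ n, ((ContDiff ℝ (⊤ : ℕ∞) (w n) ∧ VectorCalculus.IsDivFree (w n) ∧
            (∫⁻ x, ‖iteratedFDeriv ℝ 0 (w n) x‖ₑ ^ 2 < ⊤) ∧ (∫⁻ x, ‖iteratedFDeriv ℝ 1 (w n) x‖ₑ ^ 2 < ⊤) ∧
            (∫⁻ x, ‖iteratedFDeriv ℝ 2 (w n) x‖ₑ ^ 2 < ⊤)) ∧ 0 < (∫ x, ‖curl (w n) x‖ ^ 2) ∧
            (∫ x, ⟪curl (w n) x, fderiv ℝ (w n) x (curl (w n) x)⟫_ℝ) = c * (∫ x, ‖curl (w n) x‖ ^ 2) ^ (3 / 4 : ℝ) *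
              (∫ x, frobeniusNormSq (fderiv ℝ (curl (w n)) x)) ^ (3 / 4 : ℝ) ∧
            (∫ x, frobeniusNormSq (fderiv ℝ (curl (w n)) x)) = 81 * c ^ 4 / (256 * ν ^ 4) * (∫ x, ‖curl (w n) x‖ ^ 2) ^ 3)) ∧
          (∀ n, 0 < τ n) ∧ Tendsto τ atTop (𝓝 0) ∧
          Tendsto (fun n => ∫ x, ‖curl (w n) x‖ ^ 2) atTop (𝓝 (∫ x, ‖curl m x‖ ^ 2)) ∧
          ∀ x, Tendsto (fun n => (τ n)⁻¹ • (w n x - m x)) atTop (𝓝 (h x))) →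
        ∃ (d : EuclideanSpace ℝ (Fin 3)) (W : EuclideanSpace ℝ (Fin 3) →L[ℝ] EuclideanSpace ℝ (Fin 3)) (c' : ℝ),
          (∀ x y : EuclideanSpace ℝ (Fin 3), ⟪W x, y⟫_ℝ = -⟪x, W y⟫_ℝ) ∧
          ∀ x, h x = fderiv ℝ m x d + (fderiv ℝ m x (W x) - W (m x)) + c' • (m x + fderiv ℝ m x x)) →
      ∀ s s₁ : ℝ, 0 < s → s < s₁ → s₁ < T → ¬ (∀ σ ∈ Icc s s₁, ((ContDiff ℝ (⊤ : ℕ∞) (u σ) ∧ VectorCalculus.IsDivFree (u σ) ∧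
        (∫⁻ x, ‖iteratedFDeriv ℝ 0 (u σ) x‖ₑ ^ 2 < ⊤) ∧ (∫⁻ x, ‖iteratedFDeriv ℝ 1 (u σ) x‖ₑ ^ 2 < ⊤) ∧
        (∫⁻ x, ‖iteratedFDeriv ℝ 2 (u σ) x‖ₑ ^ 2 < ⊤)) ∧ 0 < (∫ x, ‖curl (u σ) x‖ ^ 2) ∧
        (∫ x, ⟪curl (u σ) x, fderiv ℝ (u σ) x (curl (u σ) x)⟫_ℝ) = c * (∫ x, ‖curl (u σ) x‖ ^ 2) ^ (3 / 4 : ℝ) *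
          (∫ x, frobeniusNormSq (fderiv ℝ (curl (u σ)) x)) ^ (3 / 4 : ℝ) ∧
        (∫ x, frobeniusNormSq (fderiv ℝ (curl (u σ)) x)) = 81 * c ^ 4 / (256 * ν ^ 4) * (∫ x, ‖curl (u σ) x‖ ^ 2) ^ 3)) := by
  obtain ⟨c, hsharp, hbud⟩ := exists_budget_saturated_iff_normalisedMaximiser
  refine ⟨c, hsharp, fun ν T hν hT u p hmax hLH hdec hTC s s₁ hs0 hss₁ hs₁T hNM => ?_⟩
  have hc : 0 < c := hsharp.1
  have hs : s ∈ Ioo 0 T := ⟨hs0, hss₁.trans hs₁T⟩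
  have hcl := hmax.isClassicalNSSolutionOn
  -- continuity of the enstrophy at `s` (the budget's `Zr` agrees with `Z(u ·)` on `(0,T)`)
  obtain ⟨Zr, D, hZD, -⟩ := hbud ν T hν hT u p hmax hLH hdec
  have hZcont : ContinuousAt (fun t => ∫ x, ‖curl (u t) x‖ ^ 2) s := by
    have hder : HasDerivAt Zr (D s) s := (hZD s hs).2.2.2.2.1
    refine (hder.continuousAt).congr ?_
    filter_upwards [isOpen_Ioo.mem_nhds hs] with t ht
    exact (hZD t ht).2.2.2.1
  -- the right difference quotients along the flow, from the maximiser `u s`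
  set τ : ℕ → ℝ := fun n => (s₁ - s) / ((n : ℝ) + 2) with hτdef
  have hτpos : ∀ n, 0 < τ n := fun n => div_pos (sub_pos.2 hss₁) (by positivity)
  have hτle : ∀ n, τ n ≤ s₁ - s := fun n => by
    rw [hτdef]
    exact div_le_self (sub_pos.2 hss₁).le (by linarith [(Nat.cast_nonneg n : (0 : ℝ) ≤ n)])
  have hτlim : Tendsto τ atTop (𝓝 0) := by
    have h1 : Tendsto (fun n : ℕ => ((n : ℝ) + 2)⁻¹) atTop (𝓝 0) :=
      tendsto_inv_atTop_zero.comp (tendsto_natCast_atTop_atTop.atTop_add tendsto_const_nhds)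
    have h2 := h1.const_mul (s₁ - s)
    rw [mul_zero] at h2
    refine h2.congr fun n => ?_
    simp only [hτdef, div_eq_mul_inv]
  have hmemI : ∀ n, s + τ n ∈ Icc s s₁ := fun n => ⟨by linarith [hτpos n], by linarith [hτle n]⟩
  -- `∂ₜu(s)` is a pointwise right tangent of the maximiser set at `u s`
  have hZconv : Tendsto (fun n => ∫ x, ‖curl (u (s + τ n)) x‖ ^ 2) atTop (𝓝 (∫ x, ‖curl (u s) x‖ ^ 2)) := by
    have hst : Tendsto (fun n => s + τ n) atTop (𝓝 s) := by
      have := hτlim.const_add s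
      rwa [add_zero] at this
    exact hZcont.tendsto.comp hst
  obtain ⟨d, W, c', hW, hgen⟩ := hTC (u s) (hNM s ⟨le_rfl, hss₁.le⟩) (timeDerivWithin (Ico 0 T) u s)
    ⟨fun n => u (s + τ n), τ, fun n => hNM _ (hmemI n), hτpos, hτlim, hZconv,
      fun x => tendsto_slope_time hmax hs hτpos hτlim x⟩
  -- the momentum equation makes `u s` a relative equilibrium
  have hπ : ContDiff ℝ (⊤ : ℕ∞) (p s) := hcl.contDiff_pressure ⟨hs.1.le, hs.2⟩
  refine partB_holds c ν hc hν (u s) (hNM s ⟨le_rfl, hss₁.le⟩) (p s) d W c' hπ hW fun x => ?_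
  have hmom := hcl.momentum s ⟨hs.1.le, hs.2⟩ x
  simp only [Pi.zero_apply, add_zero] at hmom
  rw [← hgen x, show ν • Δ (u s) x - convect (u s) (u s) x - gradient (p s) x =
    (ν • Δ (u s) x - gradient (p s) x) - convect (u s) (u s) x by abel, ← hmom]
  abel

/-- **(TC_Z) ⟹ every interval `[s,s₁] ⊂ (0,T)` carries a non-maximiser instant** (route clause negated). [folklore] -/
theorem exists_nonMaximiser_instant_of_tangentCone_enstrophy :
    ∃ c : ℝ, (0 < c ∧ (∀ v : EuclideanSpace ℝ (Fin 3) → EuclideanSpace ℝ (Fin 3), (ContDiff ℝ (⊤ : ℕ∞) v ∧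
      VectorCalculus.IsDivFree v ∧ (∫⁻ x, ‖iteratedFDeriv ℝ 0 v x‖ₑ ^ 2 < ⊤) ∧ (∫⁻ x, ‖iteratedFDeriv ℝ 1 v x‖ₑ ^ 2 < ⊤) ∧
      (∫⁻ x, ‖iteratedFDeriv ℝ 2 v x‖ₑ ^ 2 < ⊤)) → (∫ x, ⟪curl v x, fderiv ℝ v x (curl v x)⟫_ℝ) ≤
      c * (∫ x, ‖curl v x‖ ^ 2) ^ (3 / 4 : ℝ) * (∫ x, frobeniusNormSq (fderiv ℝ (curl v) x)) ^ (3 / 4 : ℝ)) ∧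
      ∀ c' : ℝ, (∀ w : EuclideanSpace ℝ (Fin 3) → EuclideanSpace ℝ (Fin 3), (ContDiff ℝ (⊤ : ℕ∞) w ∧
      VectorCalculus.IsDivFree w ∧ (∫⁻ x, ‖iteratedFDeriv ℝ 0 w x‖ₑ ^ 2 < ⊤) ∧ (∫⁻ x, ‖iteratedFDeriv ℝ 1 w x‖ₑ ^ 2 < ⊤) ∧
      (∫⁻ x, ‖iteratedFDeriv ℝ 2 w x‖ₑ ^ 2 < ⊤)) → (∫ x, ⟪curl w x, fderiv ℝ w x (curl w x)⟫_ℝ) ≤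
      c' * (∫ x, ‖curl w x‖ ^ 2) ^ (3 / 4 : ℝ) * (∫ x, frobeniusNormSq (fderiv ℝ (curl w) x)) ^ (3 / 4 : ℝ)) → c ≤ c') ∧
      ∀ (ν T : ℝ), 0 < ν → 0 < T →
      ∀ (u : ℝ → EuclideanSpace ℝ (Fin 3) → EuclideanSpace ℝ (Fin 3)) (p : ℝ → EuclideanSpace ℝ (Fin 3) → ℝ),
      IsMaximalSmoothSolution ν 0 u p T → IsLerayHopfOn T ν 0 (u 0) u → HasRapidSpatialDecay (u 0) →
      (∀ m : EuclideanSpace ℝ (Fin 3) → EuclideanSpace ℝ (Fin 3), ((ContDiff ℝ (⊤ : ℕ∞) m ∧ VectorCalculus.IsDivFree m ∧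
        (∫⁻ x, ‖iteratedFDeriv ℝ 0 m x‖ₑ ^ 2 < ⊤) ∧ (∫⁻ x, ‖iteratedFDeriv ℝ 1 m x‖ₑ ^ 2 < ⊤) ∧
        (∫⁻ x, ‖iteratedFDeriv ℝ 2 m x‖ₑ ^ 2 < ⊤)) ∧ 0 < (∫ x, ‖curl m x‖ ^ 2) ∧
        (∫ x, ⟪curl m x, fderiv ℝ m x (curl m x)⟫_ℝ) = c * (∫ x, ‖curl m x‖ ^ 2) ^ (3 / 4 : ℝ) *
          (∫ x, frobeniusNormSq (fderiv ℝ (curl m) x)) ^ (3 / 4 : ℝ) ∧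
        (∫ x, frobeniusNormSq (fderiv ℝ (curl m) x)) = 81 * c ^ 4 / (256 * ν ^ 4) * (∫ x, ‖curl m x‖ ^ 2) ^ 3) →
        ∀ h : EuclideanSpace ℝ (Fin 3) → EuclideanSpace ℝ (Fin 3),
        (∃ (w : ℕ → EuclideanSpace ℝ (Fin 3) → EuclideanSpace ℝ (Fin 3)) (τ : ℕ → ℝ),
          (∀ n, ((ContDiff ℝ (⊤ : ℕ∞) (w n) ∧ VectorCalculus.IsDivFree (w n) ∧
            (∫⁻ x, ‖iteratedFDeriv ℝ 0 (w n) x‖ₑ ^ 2 < ⊤) ∧ (∫⁻ x, ‖iteratedFDeriv ℝ 1 (w n) x‖ₑ ^ 2 < ⊤) ∧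
            (∫⁻ x, ‖iteratedFDeriv ℝ 2 (w n) x‖ₑ ^ 2 < ⊤)) ∧ 0 < (∫ x, ‖curl (w n) x‖ ^ 2) ∧
            (∫ x, ⟪curl (w n) x, fderiv ℝ (w n) x (curl (w n) x)⟫_ℝ) = c * (∫ x, ‖curl (w n) x‖ ^ 2) ^ (3 / 4 : ℝ) *
              (∫ x, frobeniusNormSq (fderiv ℝ (curl (w n)) x)) ^ (3 / 4 : ℝ) ∧
            (∫ x, frobeniusNormSq (fderiv ℝ (curl (w n)) x)) = 81 * c ^ 4 / (256 * ν ^ 4) * (∫ x, ‖curl (w n) x‖ ^ 2) ^ 3)) ∧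
          (∀ n, 0 < τ n) ∧ Tendsto τ atTop (𝓝 0) ∧
          Tendsto (fun n => ∫ x, ‖curl (w n) x‖ ^ 2) atTop (𝓝 (∫ x, ‖curl m x‖ ^ 2)) ∧
          ∀ x, Tendsto (fun n => (τ n)⁻¹ • (w n x - m x)) atTop (𝓝 (h x))) →
        ∃ (d : EuclideanSpace ℝ (Fin 3)) (W : EuclideanSpace ℝ (Fin 3) →L[ℝ] EuclideanSpace ℝ (Fin 3)) (c' : ℝ),
          (∀ x y : EuclideanSpace ℝ (Fin 3), ⟪W x, y⟫_ℝ = -⟪x, W y⟫_ℝ) ∧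
          ∀ x, h x = fderiv ℝ m x d + (fderiv ℝ m x (W x) - W (m x)) + c' • (m x + fderiv ℝ m x x)) →
      ∀ s s₁ : ℝ, 0 < s → s < s₁ → s₁ < T → ∃ σ ∈ Icc s s₁, ¬ ((ContDiff ℝ (⊤ : ℕ∞) (u σ) ∧ VectorCalculus.IsDivFree (u σ) ∧
        (∫⁻ x, ‖iteratedFDeriv ℝ 0 (u σ) x‖ₑ ^ 2 < ⊤) ∧ (∫⁻ x, ‖iteratedFDeriv ℝ 1 (u σ) x‖ₑ ^ 2 < ⊤) ∧
        (∫⁻ x, ‖iteratedFDeriv ℝ 2 (u σ) x‖ₑ ^ 2 < ⊤)) ∧ 0 < (∫ x, ‖curl (u σ) x‖ ^ 2) ∧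
        (∫ x, ⟪curl (u σ) x, fderiv ℝ (u σ) x (curl (u σ) x)⟫_ℝ) = c * (∫ x, ‖curl (u σ) x‖ ^ 2) ^ (3 / 4 : ℝ) *
          (∫ x, frobeniusNormSq (fderiv ℝ (curl (u σ)) x)) ^ (3 / 4 : ℝ) ∧
        (∫ x, frobeniusNormSq (fderiv ℝ (curl (u σ)) x)) = 81 * c ^ 4 / (256 * ν ^ 4) * (∫ x, ‖curl (u σ) x‖ ^ 2) ^ 3) := by
  obtain ⟨c, hsharp, hno⟩ := no_maximiserInterval_of_tangentCone_enstrophy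
  refine ⟨c, hsharp, fun ν T hν hT u p hmax hLH hdec hTC s s₁ hs0 hss₁ hs₁T => ?_⟩
  by_contra hall
  push Not at hall
  exact hno ν T hν hT u p hmax hLH hdec hTC s s₁ hs0 hss₁ hs₁T hall

/-- **(TC_Z) ⟹ the early-deficit inequality at EVERY slice time (for one solution, some margin).** For the sharp constant `c⋆`
and every `0 < η < 1`: under (TC_Z) at `(c⋆, ν)`, along every maximal classical Leray–Hopf rapidly-decaying-datum solution, at every slice
time `s ∈ (0,T)` with `s' = s + η·W(s) < T` (`W(s) = (64ν³/(27c⋆⁴))·Z(u s)⁻²`) the early-deficit inequality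
`(1 − η + 2θ)·Z(u s)⁻² ≤ Z(u s')⁻²` holds with SOME `θ > 0`. Uniformity of `θ` (item (ii)) is NOT claimed. [folklore] -/
theorem earlyDeficit_everywhere_of_tangentCone_enstrophy :
    ∃ c : ℝ, (0 < c ∧ (∀ v : EuclideanSpace ℝ (Fin 3) → EuclideanSpace ℝ (Fin 3), (ContDiff ℝ (⊤ : ℕ∞) v ∧
      VectorCalculus.IsDivFree v ∧ (∫⁻ x, ‖iteratedFDeriv ℝ 0 v x‖ₑ ^ 2 < ⊤) ∧ (∫⁻ x, ‖iteratedFDeriv ℝ 1 v x‖ₑ ^ 2 < ⊤) ∧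
      (∫⁻ x, ‖iteratedFDeriv ℝ 2 v x‖ₑ ^ 2 < ⊤)) → (∫ x, ⟪curl v x, fderiv ℝ v x (curl v x)⟫_ℝ) ≤
      c * (∫ x, ‖curl v x‖ ^ 2) ^ (3 / 4 : ℝ) * (∫ x, frobeniusNormSq (fderiv ℝ (curl v) x)) ^ (3 / 4 : ℝ)) ∧
      ∀ c' : ℝ, (∀ w : EuclideanSpace ℝ (Fin 3) → EuclideanSpace ℝ (Fin 3), (ContDiff ℝ (⊤ : ℕ∞) w ∧
      VectorCalculus.IsDivFree w ∧ (∫⁻ x, ‖iteratedFDeriv ℝ 0 w x‖ₑ ^ 2 < ⊤) ∧ (∫⁻ x, ‖iteratedFDeriv ℝ 1 w x‖ₑ ^ 2 < ⊤) ∧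
      (∫⁻ x, ‖iteratedFDeriv ℝ 2 w x‖ₑ ^ 2 < ⊤)) → (∫ x, ⟪curl w x, fderiv ℝ w x (curl w x)⟫_ℝ) ≤
      c' * (∫ x, ‖curl w x‖ ^ 2) ^ (3 / 4 : ℝ) * (∫ x, frobeniusNormSq (fderiv ℝ (curl w) x)) ^ (3 / 4 : ℝ)) → c ≤ c') ∧
      ∀ η : ℝ, 0 < η → η < 1 → ∀ (ν T : ℝ), 0 < ν → 0 < T →
      ∀ (u : ℝ → EuclideanSpace ℝ (Fin 3) → EuclideanSpace ℝ (Fin 3)) (p : ℝ → EuclideanSpace ℝ (Fin 3) → ℝ),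
      IsMaximalSmoothSolution ν 0 u p T → IsLerayHopfOn T ν 0 (u 0) u → HasRapidSpatialDecay (u 0) →
      (∀ m : EuclideanSpace ℝ (Fin 3) → EuclideanSpace ℝ (Fin 3), ((ContDiff ℝ (⊤ : ℕ∞) m ∧ VectorCalculus.IsDivFree m ∧
        (∫⁻ x, ‖iteratedFDeriv ℝ 0 m x‖ₑ ^ 2 < ⊤) ∧ (∫⁻ x, ‖iteratedFDeriv ℝ 1 m x‖ₑ ^ 2 < ⊤) ∧
        (∫⁻ x, ‖iteratedFDeriv ℝ 2 m x‖ₑ ^ 2 < ⊤)) ∧ 0 < (∫ x, ‖curl m x‖ ^ 2) ∧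
        (∫ x, ⟪curl m x, fderiv ℝ m x (curl m x)⟫_ℝ) = c * (∫ x, ‖curl m x‖ ^ 2) ^ (3 / 4 : ℝ) *
          (∫ x, frobeniusNormSq (fderiv ℝ (curl m) x)) ^ (3 / 4 : ℝ) ∧
        (∫ x, frobeniusNormSq (fderiv ℝ (curl m) x)) = 81 * c ^ 4 / (256 * ν ^ 4) * (∫ x, ‖curl m x‖ ^ 2) ^ 3) →
        ∀ h : EuclideanSpace ℝ (Fin 3) → EuclideanSpace ℝ (Fin 3),
        (∃ (w : ℕ → EuclideanSpace ℝ (Fin 3) → EuclideanSpace ℝ (Fin 3)) (τ : ℕ → ℝ),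
          (∀ n, ((ContDiff ℝ (⊤ : ℕ∞) (w n) ∧ VectorCalculus.IsDivFree (w n) ∧
            (∫⁻ x, ‖iteratedFDeriv ℝ 0 (w n) x‖ₑ ^ 2 < ⊤) ∧ (∫⁻ x, ‖iteratedFDeriv ℝ 1 (w n) x‖ₑ ^ 2 < ⊤) ∧
            (∫⁻ x, ‖iteratedFDeriv ℝ 2 (w n) x‖ₑ ^ 2 < ⊤)) ∧ 0 < (∫ x, ‖curl (w n) x‖ ^ 2) ∧
            (∫ x, ⟪curl (w n) x, fderiv ℝ (w n) x (curl (w n) x)⟫_ℝ) = c * (∫ x, ‖curl (w n) x‖ ^ 2) ^ (3 / 4 : ℝ) *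
              (∫ x, frobeniusNormSq (fderiv ℝ (curl (w n)) x)) ^ (3 / 4 : ℝ) ∧
            (∫ x, frobeniusNormSq (fderiv ℝ (curl (w n)) x)) = 81 * c ^ 4 / (256 * ν ^ 4) * (∫ x, ‖curl (w n) x‖ ^ 2) ^ 3)) ∧
          (∀ n, 0 < τ n) ∧ Tendsto τ atTop (𝓝 0) ∧
          Tendsto (fun n => ∫ x, ‖curl (w n) x‖ ^ 2) atTop (𝓝 (∫ x, ‖curl m x‖ ^ 2)) ∧
          ∀ x, Tendsto (fun n => (τ n)⁻¹ • (w n x - m x)) atTop (𝓝 (h x))) →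
        ∃ (d : EuclideanSpace ℝ (Fin 3)) (W : EuclideanSpace ℝ (Fin 3) →L[ℝ] EuclideanSpace ℝ (Fin 3)) (c' : ℝ),
          (∀ x y : EuclideanSpace ℝ (Fin 3), ⟪W x, y⟫_ℝ = -⟪x, W y⟫_ℝ) ∧
          ∀ x, h x = fderiv ℝ m x d + (fderiv ℝ m x (W x) - W (m x)) + c' • (m x + fderiv ℝ m x x)) →
      ∀ s ∈ Ioo 0 T, s + η * (64 * ν ^ 3 / (27 * c ^ 4) * (∫ x, ‖curl (u s) x‖ ^ 2)⁻¹ ^ 2) < T →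
        ∃ θ : ℝ, 0 < θ ∧ (1 - η + 2 * θ) * (∫ x, ‖curl (u s) x‖ ^ 2)⁻¹ ^ 2 ≤
          (∫ x, ‖curl (u (s + η * (64 * ν ^ 3 / (27 * c ^ 4) * (∫ x, ‖curl (u s) x‖ ^ 2)⁻¹ ^ 2))) x‖ ^ 2)⁻¹ ^ 2 := by
  obtain ⟨c, hsharp, hED⟩ := earlyDeficit_pos_of_nonMaximiser_instant
  obtain ⟨c₄, hsharp₄, h4⟩ := exists_nonMaximiser_instant_of_tangentCone_enstrophy
  have hc₄ : c₄ = c := sharp_const_unique hsharp₄ hsharp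
  subst hc₄
  obtain ⟨c₁, -, hbud⟩ := exists_budget_saturated_iff_normalisedMaximiser
  refine ⟨c₄, hsharp₄, fun η hη0 hη1 ν T hν hT u p hmax hLH hdec hTC s hs hs'T => ?_⟩
  have hc : 0 < c₄ := hsharp₄.1
  obtain ⟨Zr, D, hZD, -⟩ := hbud ν T hν hT u p hmax hLH hdec
  have hZpos : 0 < ∫ x, ‖curl (u s) x‖ ^ 2 := by
    have h1 := lintegral_curl_sq_pos hν hT hmax hLH hdec s ⟨hs.1.le, hs.2⟩
    rw [(hZD s hs).1] at h1
    rw [← (hZD s hs).2.2.2.1]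
    exact ENNReal.ofReal_pos.1 h1
  set W : ℝ := η * (64 * ν ^ 3 / (27 * c₄ ^ 4) * (∫ x, ‖curl (u s) x‖ ^ 2)⁻¹ ^ 2) with hW
  have hWpos : 0 < W := mul_pos hη0 (mul_pos (by positivity) (pow_pos (inv_pos.2 hZpos) 2))
  obtain ⟨σ, hσ, hnot⟩ := h4 ν T hν hT u p hmax hLH hdec hTC s (s + W / 2) hs.1 (by linarith) (by linarith)
  exact hED η hη0 hη1 ν T hν hT u p hmax hLH hdec s hs hs'T σ ⟨hσ.1, by linarith [hσ.2]⟩ hnot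

end TangentCone

end RigidExit

end Summit.NavierStokesRegularity.NavierStokesRegularity.Theorems
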